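import Literature.IUT.HodgeArakelov.ThetaEvaluationSettingProofs3
import Literature.IUT.HodgeTheaters.TemperedCoverings
import HarnessLib

/-!
# [IUTchII] Prop. 2.2 (i)′: the residual "`Π_{v•}·Δ = Π_v`" supplied by [IUTchI] Cor. 2.3 (iii) — a bridge

S. Mochizuki, *Inter-universal Teichmüller theory II*, kurims manuscript (Dec. 2020) §2, Prop. 2.2 (i) p. 66
(claim key `Mochizuki2012`, DISPUTED, D-0012); [IUTchI] (kurims, May 2020) §2, Cor. 2.3 (iii) p. 47: "we obtain
natural exact sequences of center-free topological groups `1 → Δ^tp_{X,ℍ} → Π^tp_{X,ℍ} → G_k → 1`".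
Proof-only companion (abc-iut cell, D-0067 wave 4, seat abc-iut-w4-d034; cone of [IUTchIII] Cor. 3.12, DAG node
**IUTchII:Prop2.2(i)**; GAP-LEDGER row G-w4d010-1, D-row "narrowed to (SJ)"); no definitions, no new named fact;
the audited modules `ThetaEvaluationSetting*.lean` (abc-iut-L6-t1 / L6-d1 / w4-d010) and
`HodgeTheaters/TemperedCoverings.lean` (abc-iut-L5-t1, [IUTchI] §2) are imported unchanged. Nothing here takes a
side on [IUTchIII] Cor. 3.12; typed ≠ proved.

THE RESIDUAL. abc-iut-w4-d010's `prop22_i'_of_groupTheoretic` (p412492) proves the repaired [IUTchII] Prop. 2.2 (i)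
(`Prop22_i'`) from the landed anabelian input `SubgraphReference.GroupTheoretic`, the normality `Π_Ÿ(Π_v) ⊴ Π_v`,
and ONE more input
  (SJ) `∃ e₀ : P ≃ₜ* Π^tp_{X̲̲_v}, ∀ x, ∃ b, e₀ b ∈ Π^tp_{X,Γ•} ∧ projG(isoX b) = projG(isoX x)`
("along one identification with the reference, the decomposition group of the vertex labelled `0` surjects onto
the Galois group", read through the mono-theta reconstruction `E.recon.projG`). This file reduces (SJ):

* `SubgraphReference.exists_bullet_of_map_aug_eq_top` — (SJ) for EVERY `E : EnvOfGroup` ⟸ the reference-side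
  statement `Π^tp_{X,Γ•} ↠ G_v`, i.e. `R.refBullet.map S.aug = ⊤`: take `e₀ := E.isoX ≫ e` with `e` the
  identification of `Reconstruction.projG_corresponds` (`Ker projG ↦ Δ_v`), so that `projG(isoX b) = projG(isoX x)`
  iff `e₀ b ≡ e₀ x (mod Δ_v)` — pure bookkeeping over abc-iut-L6-t1's interfaces;
* `SubgraphReference.map_aug_eq_top_of_cor23iii` — `Π^tp_{X,Γ•} ↠ G_v` ⟸ [IUTchI] Cor. 2.3 (iii) (abc-iut-L5-t1's
  named predicate `StableCurveTemperedData.Cor23iii`, clause `exact_tp`: `Π^tp_{X,ℍ} ↠ G_k`, under `Cor23Hyp`)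
  + IDENTIFICATION DATA ONLY between the [IUTchII] reference datum and the [IUTchI] §2 datum of the curve `X̲̲_v`
  with `ℍ := Γ•_X` (an isomorphism `eD : Π_v ≅ Π^tp_X` carrying `Π^tp_{X,Γ•}` (`R.refBullet`) onto `Π^tp_{X,ℍ}`
  (`D.piTpXH`) and matching the kernels of the two augmentations) — the L5↔L6 bridge of the D-row of G-w4d010-1
  ("owner: the [IUTchI] Cor 2.3 (iii) ⟷ SubgraphReference merge");
* `prop22_i'_of_cor23iii` — composition with p412492: `Prop22_i'` from `GroupTheoretic` + normality +
  [IUTchI] Cor. 2.3 (iii) BY NAME + the identification.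

[claim: Mochizuki2012, status: disputed] Deliberately NOT here: the construction of the identification (the
merge itself), [IUTchI] Cor. 2.3 (iii) (an L5 node), anything on Prop. 2.2 (ii).
-/

namespace Literature.IUT.HodgeArakelov

universe u

variable {S : BadPlaceSetting.{u}} {P : TopGroup.{u}}

/-! ## 1. (SJ) from `Π^tp_{X,Γ•} ↠ G_v` (bookkeeping over the mono-theta reconstruction) -/

/-- **(SJ) ⟸ `Π^tp_{X,Γ•} ↠ G_v`.** If the reference decomposition group `Π^tp_{X,Γ•} ⊆ Π^tp_{X̲̲_v}` maps ONTO
`G_v` under the augmentation, then for every Prop. 1.2 (i) output `E` (mono-theta environment `M^Θ(Π_v)` with its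
reconstruction `Π_v ≅ Π_X(M^Θ) ↠ G`), along the identification `e₀ := E.isoX ≫ e` (with `e : Π_X(M^Θ) ≅ Π^tp_{X̲̲_v}`
carrying `Ker(Π_X ↠ G)` to `Δ_v`, field `Reconstruction.projG_corresponds`) every `x ∈ Π_v` is congruent modulo
`Ker(projG ∘ isoX)` to some `b` with `e₀ b ∈ Π^tp_{X,Γ•}` — the hypothesis `hsurj` of
`prop22_i'_of_groupTheoretic`. [claim: Mochizuki2012, status: disputed] -/
theorem SubgraphReference.exists_bullet_of_map_aug_eq_top (R : SubgraphReference S)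
    (E : EnvOfGroup S.toThetaSetting P) (h : R.refBullet.map S.aug = ⊤) :
    ∃ e₀ : P ≃ₜ* S.PiX, ∀ x : P, ∃ b : P, e₀ b ∈ R.refBullet ∧
      E.recon.projG (E.isoX b) = E.recon.projG (E.isoX x) := by
  obtain ⟨e, he⟩ := E.recon.projG_corresponds
  refine ⟨E.isoX.trans e, fun x => ?_⟩
  -- choose `b' ∈ Π^tp_{X,Γ•}` with the same image in `G_v` as `e (isoX x)`
  have hx : S.aug (e (E.isoX x)) ∈ R.refBullet.map S.aug := by
    rw [h]
    exact Subgroup.mem_top _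
  obtain ⟨b', hb', hab⟩ := hx
  refine ⟨E.isoX.symm (e.symm b'), ?_, ?_⟩
  · rw [ContinuousMulEquiv.trans_apply, ContinuousMulEquiv.apply_symm_apply,
      ContinuousMulEquiv.apply_symm_apply]
    exact hb'
  · rw [ContinuousMulEquiv.apply_symm_apply]
    -- `b'⁻¹ · e(isoX x) ∈ Δ_v = e(Ker projG)`
    have hΔ : b'⁻¹ * e (E.isoX x) ∈ S.DeltaX := by
      change b'⁻¹ * e (E.isoX x) ∈ S.aug.ker
      rw [MonoidHom.mem_ker, map_mul, map_inv, hab, inv_mul_cancel]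
    rw [← he] at hΔ
    obtain ⟨k, hk, hkb⟩ := hΔ
    -- `k = e⁻¹(b'⁻¹ · e(isoX x)) = (e⁻¹ b')⁻¹ · isoX x`
    have hk' : k = (e.symm b')⁻¹ * E.isoX x := by
      have hkb' : e k = b'⁻¹ * e (E.isoX x) := hkb
      apply e.injective
      rw [hkb', map_mul, map_inv, ContinuousMulEquiv.apply_symm_apply]
    rw [hk'] at hk
    have hk1 : E.recon.projG ((e.symm b')⁻¹ * E.isoX x) = 1 := hk
    rwa [map_mul, map_inv, inv_mul_eq_one] at hk1

/-! ## 2. `Π^tp_{X,Γ•} ↠ G_v` from [IUTchI] Cor. 2.3 (iii) along an identification (the L5↔L6 bridge) -/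

/-- **`Π^tp_{X,Γ•} ↠ G_v` ⟸ [IUTchI] Cor. 2.3 (iii).** Let the reference group `Π_v = Π^tp_{X̲̲_v}` of a
`BadPlaceSetting` be identified with the tempered fundamental group `Π^tp_X` of an [IUTchI] §2 datum `D`
(abc-iut-L5-t1's `StableCurveTemperedData`, for the curve `X̲̲_v` with `ℍ := Γ•_X`) by an isomorphism of
topological groups `eD` carrying the reference decomposition group `Π^tp_{X,Γ•}` (`R.refBullet`) onto
`Π^tp_{X,ℍ}` (`D.piTpXH`) and the kernel of `Π_v ↠ G_v` onto the kernel of `Π^tp_X ↠ G_k`. Then the exactness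
clause of [IUTchI] Cor. 2.3 (iii) ("`1 → Δ^tp_{X,ℍ} → Π^tp_{X,ℍ} → G_k → 1`", the named predicate `Cor23iii`,
clause `exact_tp`, under its hypothesis `Cor23Hyp`) gives `Π^tp_{X,Γ•}·Δ_v = Π_v`, i.e. `Π^tp_{X,Γ•} ↠ G_v`.
[claim: Mochizuki2012, status: disputed] -/
theorem SubgraphReference.map_aug_eq_top_of_cor23iii (R : SubgraphReference S)
    (D : Literature.IUT.HodgeTheaters.StableCurveTemperedData.{u}) (hH : D.Cor23Hyp) (h23 : D.Cor23iii)
    (eD : S.PiX ≃ₜ* D.PiTp) (hB : R.refBullet.map eD.toMulEquiv.toMonoidHom = D.piTpXH)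
    (hker : ∀ z : S.PiX, S.aug z = 1 ↔ D.prTp (eD z) = 1) :
    R.refBullet.map S.aug = ⊤ := by
  rw [eq_top_iff]
  rintro g -
  obtain ⟨y, rfl⟩ := S.aug_surjective g
  obtain ⟨⟨h, hh⟩, hprh⟩ := (h23.exact_tp hH).2 (D.prTp (eD y))
  have hprh' : D.prTp h = D.prTp (eD y) := by
    rw [← hprh, MonoidHom.comp_apply, Subgroup.subtype_apply]
  -- `eD⁻¹ h ∈ Π^tp_{X,Γ•}`
  have hb' : eD.symm h ∈ R.refBullet := by
    have hmem : h ∈ R.refBullet.map eD.toMulEquiv.toMonoidHom := by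
      rw [hB]
      exact hh
    obtain ⟨k, hk, hkh⟩ := hmem
    have hkh' : eD k = h := hkh
    rw [← hkh', ContinuousMulEquiv.symm_apply_apply]
    exact hk
  refine ⟨eD.symm h, hb', ?_⟩
  -- `aug (eD⁻¹ h) = aug y` since `prTp h = prTp (eD y)`
  rw [← inv_mul_eq_one, ← map_inv, ← map_mul, hker, map_mul, map_inv,
    ContinuousMulEquiv.apply_symm_apply, map_mul, map_inv, hprh', inv_mul_cancel]

/-! ## 3. Composition: Prop. 2.2 (i)′ from `GroupTheoretic`, normality, [IUTchI] Cor. 2.3 (iii) and the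
identification -/

/-- **IUTchII:Prop2.2(i)′ ⟸ `GroupTheoretic` + `Π_Ÿ(Π_v) ⊴ Π_v` + [IUTchI] Cor. 2.3 (iii) BY NAME + identification**
(composition of abc-iut-w4-d010's `prop22_i'_of_groupTheoretic`, p412492, with the two reductions above): for the
reference pair `R`, a Prop. 2.1 output `T`, a Prop. 1.4 output `D'` with `Π_Ÿ(Π_v)` normal, a Prop. 1.2 (i)
output `E` with pointed inversion `ι₀`, and an [IUTchI] §2 datum `D` of `X̲̲_v` (`ℍ = Γ•_X`) identified with the
reference as in `map_aug_eq_top_of_cor23iii`, the repaired statement `Prop22_i' R T D' ι₀` holds.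
[claim: Mochizuki2012, status: disputed] -/
theorem prop22_i'_of_cor23iii (R : SubgraphReference S) (T : TemperedCoverings S P)
    (D' : EtaleThetaData S.toThetaSetting P) {E : EnvOfGroup S.toThetaSetting P} (ι₀ : PointedInversion E D')
    (hG : R.GroupTheoretic) (hN : D'.PiYdd.Normal)
    (D : Literature.IUT.HodgeTheaters.StableCurveTemperedData.{u}) (hH : D.Cor23Hyp) (h23 : D.Cor23iii)
    (eD : S.PiX ≃ₜ* D.PiTp) (hB : R.refBullet.map eD.toMulEquiv.toMonoidHom = D.piTpXH)
    (hker : ∀ z : S.PiX, S.aug z = 1 ↔ D.prTp (eD z) = 1) :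
    Prop22_i' R T D' ι₀ :=
  prop22_i'_of_groupTheoretic R T D' ι₀ hG hN
    (R.exists_bullet_of_map_aug_eq_top E (R.map_aug_eq_top_of_cor23iii D hH h23 eD hB hker))

end Literature.IUT.HodgeArakelov
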